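import Summits.QuantumFields.YangMills.Theorems.BalabanUVNodesN08HaarCompatibilityGuard

/-!
# BalabanUVNodes ∕ N08 — OFF-AXIS CROSSING BONDS OF THE (0.4) LOOP FAMILY ARE PRIVATE: the loop of index `(r, 1, 1)` factorises as
# `X · U(q_r) · Y` through ITS OWN crossing bond `q_r`, and right-multiplying every `U(q_{r′})` by its own group element moves only that factor
# (lattice combinatorics; the measure-theoretic consequence `dU{Small ℰ · c} ≤ Haar{dist1 < δ}^(L^{d−1} − 1)` is the sequel `…GuardCrossingLaw`)

WIDTH SEAT `pub-ymgap-dag-n08-w3` g2, plan `W-SEAT-START-LIST.md` v7 §n08 item 3 PART 7 (the quantitative sharpening of part 6 p594625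
`…N08HaarCompatibilityGuard` §3), 2026-08-28.  Track A, DAG node N08 = [Balaban1985UV3] Thm 1 p. 257 (compact) + Thm 2 p. 272; key item K1⁷
`StabilityBAtRecordR13SepCoPH` (stmt-QuantumFields-20542), `--supports … --as helper`.  COUNT-NEUTRAL.

THE POINT.  Part 6 bounded the guard of one coarse bond `c = ⟨y, y + e_μ⟩` by ONE loop variable (`dU{Small_c} ≤ h := Haar{dist1 < δ}`), which makes
`dU(guard) ≤ #PBond · h` vacuous on fine lattices.  The small-field domain of [Balaban1987RG1] (0.4) p. 253 constrains, among its `(d!)²·L^d` loop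
variables `U(Γ ∪ [x,x′] ∪ (−Γ′) ∪ (−c))`, the ones through the OFF-AXIS points `x = emb y + n` with `n_μ = 0`, `n⊥ ≠ 0` (index `(r, 1, 1)`): the
transported segment `[x, x′]` of such a loop crosses the face between `B(y)` and `B(y + e_μ)` through ITS OWN fine bond `q_n = ⟨emb y + n + ((L−1)∕2) e_μ, μ⟩`,
and that bond is met by NO staircase (staircases only move in directions of nonzero offset, and `n_μ = 0`), by no other bond of any of these segments
(longitudinal coordinate), and not by the axis of `c` (transverse coordinate).  Right-multiplying each `U(q_n)` by its own `k_n` therefore preserves `dU`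
and right-translates (a conjugate of) each of these loop variables by its own `k_n`: their JOINT LAW is right-invariant under the product group, hence
product Haar (Weil uniqueness, `AveragingRT.measure_eq_mass_smul_of_invariant`), and `dist1` is conjugation invariant.

WHAT THIS FILE PROVES ([folklore] lattice combinatorics over landed modules — `BlockAveraging`, `BlockAveragingHaarAC`, `AveragingRT`; nothing of Bałaban's
asserted; the crossing bonds are spelled as a HYPOTHESIS `hqv` on an indexed bond family `qv`, no new object).  §1 words: `apply_ne_zero_of_mem_stairWord`
(letters of `Γ^σ` have nonzero offset), `exists_fst_eq_of_mem_wordRev`.  §2 coordinates of the crossing bonds (`cross_src_apply`) and PRIVACY: no staircase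
bond (`ne_cross_of_mem_walk_stairWord`, `…_wordRev_stairWord`), no axis bond (`ne_cross_of_mem_walk_axis`), no bond of the first ∕ second half of any of
the segments (`ne_cross_of_mem_walk_prefix` ∕ `…_suffix`) is an off-axis crossing bond; distinct offsets give distinct bonds (`cross_injective`).  §3 the loop
of index `(r, 1, 1)` FACTORISES as `X · U(qv i) · Y` (`loopHol_eq_mul_apply_cross_mul`), and the multi-shear `U ↦ U · (k ∘ qv⁻¹)` fixes `X`, `Y`, `U(c)` and
sends `U(qv i) ↦ U(qv i)·k i` (`holAt_mulRight_extend_of_forall_ne`, `axialAvg_mulRight_extend`, ★ `loopHol_mulRight_extend`).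

HONEST FRAMING.  Lattice bookkeeping feeding the sequel's sharper bound on WHERE the typed E6′ letter `Ū_*(dU) = dV` can fail (part 6: only on the guard);
NOT a decision of E6′ (part 6's `measure_guard_pos` stands: the guard is not `dU`-null); count-neutral; N08 NOT discharged; counts unmoved (typed 28∕28 · discharged 5∕27); one
finite 𝕋⁴ programme at fixed ε — R4 closes the CONDITIONAL rung `BalabanLadder.UV` only; the Yang–Mills mass gap (Clay) is NOT proved by any of this;
nothing continuum ∕ ℝ³ ∕ ℝ⁴ ∕ OS ∕ mass gap.  0 `sorry`, 0 `def`, 0 `instance`, standard axioms.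
-/

noncomputable section

open MeasureTheory

namespace Summit.QuantumFields.YangMills.BalabanUVNodes.N08HaarCompatibilityGuardCrossing

open Literature.MathematicalPhysics.QuantumFieldTheory.Balaban1983to89
open Literature.MathematicalPhysics.QuantumFieldTheory.Balaban1983to89.T4Continuum
open Literature.MathematicalPhysics.QuantumFieldTheory.Balaban1983to89.T4ReflectionCone (netDisp_append netDisp_replicate holAt_congr)
open Literature.MathematicalPhysics.QuantumFieldTheory.Balaban1983to89.AveragingRT
  (axialAvg map_axialAvg measurable_axialAvg measurePreserving_mulRight measure_eq_mass_smul_of_invariant two_mul_half_add_one)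
open Literature.MathematicalPhysics.QuantumFieldTheory.Balaban1983to89.BlockAveraging
  (Idx off off_bounds loopHol Small avgFun measurableSet_small measurable_avgFun measurable_loopHol)
open Literature.MathematicalPhysics.QuantumFieldTheory.Balaban1983to89.BlockAveragingHaarAC
  (IsCentral letter_mem_of_mem_walk mem_walk_replicate L_dvd_of_emb_add_eq apply_eq_of_emb_add_eq eq_zero_of_L_dvd
    loopHol_eq_openHol_mul openHol openWord)

/-! ## §1. Words: staircases move only in directions of nonzero offset -/

section Words

variable {d : ℕ}

/-- Every letter of a run `axisRun a k` is in direction `a`, and the run is empty when `k = 0`. [folklore] -/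
theorem fst_eq_of_mem_axisRun {a : Fin d} {k : ℤ} {l : Letter d} (hl : l ∈ axisRun a k) : l.1 = a ∧ k ≠ 0 := by
  unfold axisRun at hl
  rw [List.mem_replicate] at hl
  refine ⟨by rw [hl.2], fun hk => ?_⟩
  rw [hk] at hl
  exact hl.1 rfl

/-- Every letter of a staircase through a list of axes is in a listed direction of NONZERO offset. [folklore] -/
theorem apply_ne_zero_of_mem_stairRuns (n : Fin d → ℤ) : ∀ (as : List (Fin d)) {l : Letter d}, l ∈ stairRuns n as → n l.1 ≠ 0
  | [], l, hl => by simp [stairRuns] at hl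
  | a :: as, l, hl => by
    simp only [stairRuns, List.mem_append] at hl
    rcases hl with hl | hl
    · obtain ⟨h1, h2⟩ := fst_eq_of_mem_axisRun hl
      rwa [h1]
    · exact apply_ne_zero_of_mem_stairRuns n as hl

/-- **A STAIRCASE `Γ^σ_{y,x}` ONLY MOVES IN DIRECTIONS OF NONZERO OFFSET**: every letter `(κ, ±)` of `stairWord σ n` has `n κ ≠ 0`.
[cite: Balaban1987RG1, (0.3) p.252 («indices μ with nonzero numbers n_μ»; bookkeeping)] -/
theorem apply_ne_zero_of_mem_stairWord (σ : Equiv.Perm (Fin d)) (n : Fin d → ℤ) {l : Letter d} (hl : l ∈ stairWord σ n) : n l.1 ≠ 0 :=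
  apply_ne_zero_of_mem_stairRuns n _ hl

/-- The letters of the reversed word are the flipped letters: same directions. [folklore] -/
theorem exists_fst_eq_of_mem_wordRev {w : List (Letter d)} {l : Letter d} (hl : l ∈ wordRev w) : ∃ l' ∈ w, l'.1 = l.1 := by
  unfold wordRev at hl
  rw [List.mem_reverse, List.mem_map] at hl
  obtain ⟨l', hl', rfl⟩ := hl
  exact ⟨l', hl', rfl⟩

end Words

/-! ## §2. The off-axis crossing bonds of one coarse bond: coordinates, privacy, injectivity -/

section Crossing

variable {P : Params} {j : ℕ} (c : PBond P (j + 1)) {ι : Type*} (rv : ι → (Fin P.d → Fin P.L)) (qv : ι → PBond P j)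

/-- THE CROSSING BONDS, spelled as a hypothesis on an indexed family (no new object): `qv i` is the bond of the transported segment `[x, x′]`,
`x = emb c₋ + off (rv i)`, reached after `(L−1)∕2` steps — for `off (rv i)` longitudinally `0` the fine bond through the face between `B(c₋)` and `B(c₊)`
at transverse offset `off (rv i)`.  `qv` is only ever used through this hypothesis `hqv`. [cite: Balaban1987RG1, (0.4) p.253 (bookkeeping)] -/
theorem cross_dir (hqv : ∀ i, qv i = ⟨walkEnd (emb c.src) (stairWord 1 (off (rv i)) ++ List.replicate ((P.L - 1) / 2) (c.dir, true)), c.dir⟩)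
    (i : ι) : (qv i).dir = c.dir := by
  rw [hqv]

variable (hqv : ∀ i, qv i = ⟨walkEnd (emb c.src) (stairWord 1 (off (rv i)) ++ List.replicate ((P.L - 1) / 2) (c.dir, true)), c.dir⟩)
  (h0 : ∀ i, off (rv i) c.dir = 0)
include hqv

/-- Coordinates of the crossing bond: `(qv i)₋ = emb c₋ + off (rv i) + ((L−1)∕2) e_μ`. [folklore] -/
theorem cross_src_apply (i : ι) (ν : Fin P.d) :
    (qv i).src ν = emb c.src ν + (((off (rv i) ν + if ν = c.dir then (((P.L - 1) / 2 : ℕ) : ℤ) else 0 : ℤ)) : ZMod (P.sitesPerDir j)) := by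
  rw [hqv]
  show walkEnd (emb c.src) _ ν = _
  rw [walkEnd_apply, netDisp_append, netDisp_stairWord, netDisp_replicate]
  by_cases h : ν = c.dir
  · subst h; simp
  · simp [h, Ne.symm h]

/-- **NO STAIRCASE BOND IS AN OFF-AXIS CROSSING BOND**: along `Γ^σ` with offsets `n`, `n_μ = 0`, every bond has a direction of nonzero offset, hence `≠ μ`.
[cite: Balaban1987RG1, (0.3) p.252 (bookkeeping)] -/
theorem ne_cross_of_mem_walk_stairWord {n : Fin P.d → ℤ} (hn : n c.dir = 0) (σ : Equiv.Perm (Fin P.d)) (x : Site P j) {s : LStep P j}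
    (hs : s ∈ walk x (stairWord σ n)) (i : ι) : s.bond ≠ qv i := by
  intro h
  have hne := apply_ne_zero_of_mem_stairWord σ n (letter_mem_of_mem_walk x _ s hs)
  simp only at hne
  rw [h, cross_dir c rv qv hqv] at hne
  exact hne hn

/-- … nor is any bond of the REVERSED staircase `−Γ′`. [cite: Balaban1987RG1, (0.3) p.252 (bookkeeping)] -/
theorem ne_cross_of_mem_walk_wordRev_stairWord {n : Fin P.d → ℤ} (hn : n c.dir = 0) (σ : Equiv.Perm (Fin P.d)) (x : Site P j)
    {s : LStep P j} (hs : s ∈ walk x (wordRev (stairWord σ n))) (i : ι) : s.bond ≠ qv i := by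
  intro h
  obtain ⟨l', hl', hl⟩ := exists_fst_eq_of_mem_wordRev (letter_mem_of_mem_walk x _ s hs)
  have hne := apply_ne_zero_of_mem_stairWord σ n hl'
  rw [hl] at hne
  simp only at hne
  rw [h, cross_dir c rv qv hqv] at hne
  exact hne hn

/-- **THE AXIS OF `c` MEETS NO OFF-AXIS CROSSING BOND** (transverse coordinate; standing range). [folklore] -/
theorem ne_cross_of_mem_walk_axis (hj : j + 1 ≤ P.m + P.K) {i : ι} (hc : ¬ IsCentral c (rv i, 1, 1)) {s : LStep P j}
    (hs : s ∈ walk (emb c.src) (List.replicate P.L (c.dir, true))) : s.bond ≠ qv i := by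
  intro h
  obtain ⟨-, -, t', -, hsrc⟩ := mem_walk_replicate hs
  apply hc
  intro ν hν
  have h1 := hsrc ν
  rw [h, cross_src_apply c rv qv hqv, if_neg hν, if_neg hν, add_zero] at h1
  have hd := L_dvd_of_emb_add_eq hj h1
  have hb := off_bounds (rv i) ν
  have hL := two_mul_half_add_one P
  have h0' := eq_zero_of_L_dvd hd (by omega) (by omega)
  show off (rv i) ν = 0
  omega

omit hqv in
/-- A longitudinal congruence `emb c₋ ν + a = emb c₋ ν + b` with `|b − a| < L` forces `a = b` (plumbing). [folklore] -/
theorem int_eq_of_emb_add_eq (hj : j + 1 ≤ P.m + P.K) {ν : Fin P.d} {a b : ℤ}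
    (h : emb c.src ν + ((a : ℤ) : ZMod (P.sitesPerDir j)) = emb c.src ν + ((b : ℤ) : ZMod (P.sitesPerDir j)))
    (h1 : -(P.L : ℤ) < b - a) (h2 : b - a < P.L) : a = b := by
  have h0' := eq_zero_of_L_dvd (L_dvd_of_emb_add_eq hj h) h1 h2
  omega

include h0 in
/-- **THE FIRST HALF OF A SEGMENT MEETS NO CROSSING BOND**: the `(L−1)∕2` bonds of `[x, x′]` before the face have longitudinal offsets `< (L−1)∕2`
(standing range). [folklore] -/
theorem ne_cross_of_mem_walk_prefix (hj : j + 1 ≤ P.m + P.K) (i : ι) {s : LStep P j}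
    (hs : s ∈ walk (walkEnd (emb c.src) (stairWord 1 (off (rv i)))) (List.replicate ((P.L - 1) / 2) (c.dir, true))) (i' : ι) :
    s.bond ≠ qv i' := by
  intro h
  obtain ⟨-, -, t', ht', hsrc⟩ := mem_walk_replicate hs
  have h1 := hsrc c.dir
  rw [h, cross_src_apply c rv qv hqv, walkEnd_apply, netDisp_stairWord, if_pos rfl, if_pos rfl, h0, h0, add_assoc, ← Int.cast_add] at h1
  have hL := two_mul_half_add_one P
  have := int_eq_of_emb_add_eq c hj h1 (by omega) (by omega)
  omega

include h0 in
/-- **THE SECOND HALF OF A SEGMENT MEETS NO CROSSING BOND**: the bonds after the face have longitudinal offsets `> (L−1)∕2`. [folklore] -/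
theorem ne_cross_of_mem_walk_suffix (hj : j + 1 ≤ P.m + P.K) (i : ι) {s : LStep P j}
    (hs : s ∈ walk (walkEnd (emb c.src) (stairWord 1 (off (rv i)) ++ List.replicate ((P.L - 1) / 2 + 1) (c.dir, true)))
      (List.replicate (P.L - 1 - (P.L - 1) / 2) (c.dir, true))) (i' : ι) : s.bond ≠ qv i' := by
  intro h
  obtain ⟨-, -, t', ht', hsrc⟩ := mem_walk_replicate hs
  have h1 := hsrc c.dir
  rw [h, cross_src_apply c rv qv hqv, walkEnd_apply, netDisp_append, netDisp_stairWord, netDisp_replicate, if_pos rfl, if_pos rfl, h0, h0,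
    add_assoc, ← Int.cast_add] at h1
  simp only [if_true] at h1
  have hL := two_mul_half_add_one P
  have := int_eq_of_emb_add_eq c hj h1 (by push_cast; omega) (by push_cast; omega)
  push_cast at this
  omega

/-- **THE OFF-AXIS CROSSING BONDS OF DISTINCT OFFSETS ARE DISTINCT** (transverse coordinates; standing range). [folklore] -/
theorem cross_injective (hj : j + 1 ≤ P.m + P.K) (hrv : Function.Injective rv) : Function.Injective qv := by
  intro i i' h
  apply hrv
  funext ν
  have hs : (qv i).src ν = (qv i').src ν := by rw [h]
  rw [cross_src_apply c rv qv hqv, cross_src_apply c rv qv hqv] at hs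
  have hb := off_bounds (rv i) ν
  have hb' := off_bounds (rv i') ν
  have hL := two_mul_half_add_one P
  have he := int_eq_of_emb_add_eq c hj hs (by omega) (by omega)
  simp only [off] at he
  exact Fin.ext (by omega)

end Crossing

/-! ## §3. The loop of index `(r, 1, 1)` factorises through its crossing bond; the multi-shear moves only that factor -/

section Shear

variable {P : Params} {j : ℕ} {G : Type*} [GaugeGroup G] (c : PBond P (j + 1)) {ι : Type*} (rv : ι → (Fin P.d → Fin P.L))
  (qv : ι → PBond P j)
  (hqv : ∀ i, qv i = ⟨walkEnd (emb c.src) (stairWord 1 (off (rv i)) ++ List.replicate ((P.L - 1) / 2) (c.dir, true)), c.dir⟩)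
  (h0 : ∀ i, off (rv i) c.dir = 0)

/-- The segment splits at the face: `L = (L−1)∕2 + (1 + (L − 1 − (L−1)∕2))` letters. [folklore] -/
theorem replicate_split (μ : Fin P.d) :
    List.replicate P.L ((μ, true) : Letter P.d) =
      List.replicate ((P.L - 1) / 2) (μ, true) ++ ((μ, true) :: List.replicate (P.L - 1 - (P.L - 1) / 2) (μ, true)) := by
  rw [← List.replicate_succ, ← List.replicate_add]
  congr 1
  have := two_mul_half_add_one P
  omega

include hqv in
/-- **THE LOOP OF INDEX `(r, 1, 1)` FACTORISES THROUGH ITS CROSSING BOND**: `U(Γ ∪ [x,x′] ∪ (−Γ′) ∪ (−c)) = X · U(q) · Y` with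
`X = U(Γ) · U(first half of [x,x′])` and `Y = U(second half) · U(−Γ′) · U(c)⁻¹`. [cite: Balaban1987RG1, (0.4) p.253 (bookkeeping)] -/
theorem loopHol_eq_mul_apply_cross_mul (U : GaugeField P j G) (i : ι) :
    loopHol U c (rv i, 1, 1) =
      (holAt U (walk (emb c.src) (stairWord 1 (off (rv i)))) *
          holAt U (walk (walkEnd (emb c.src) (stairWord 1 (off (rv i)))) (List.replicate ((P.L - 1) / 2) (c.dir, true)))) *
        U (qv i) *
        (holAt U (walk (walkEnd (emb c.src) (stairWord 1 (off (rv i)) ++ List.replicate ((P.L - 1) / 2 + 1) (c.dir, true)))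
              (List.replicate (P.L - 1 - (P.L - 1) / 2) (c.dir, true))) *
            holAt U (walk (walkEnd (walkEnd (emb c.src) (stairWord 1 (off (rv i)))) (List.replicate P.L (c.dir, true)))
              (wordRev (stairWord 1 (off (rv i))))) *
          (axialAvg U c)⁻¹) := by
  have hstep : walk (walkEnd (walkEnd (emb c.src) (stairWord 1 (off (rv i)))) (List.replicate ((P.L - 1) / 2) (c.dir, true)))
      (((c.dir, true) : Letter P.d) :: List.replicate (P.L - 1 - (P.L - 1) / 2) (c.dir, true)) =
      ⟨qv i, true⟩ :: walk (walkEnd (emb c.src) (stairWord 1 (off (rv i)) ++ List.replicate ((P.L - 1) / 2 + 1) (c.dir, true)))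
        (List.replicate (P.L - 1 - (P.L - 1) / 2) (c.dir, true)) := by
    rw [hqv, walkEnd_append, walkEnd_append, List.replicate_succ', walkEnd_append]
    rfl
  have hseg : holAt U (walk (walkEnd (emb c.src) (stairWord 1 (off (rv i)))) (List.replicate P.L (c.dir, true))) =
      holAt U (walk (walkEnd (emb c.src) (stairWord 1 (off (rv i)))) (List.replicate ((P.L - 1) / 2) (c.dir, true))) *
        (U (qv i) * holAt U (walk (walkEnd (emb c.src) (stairWord 1 (off (rv i)) ++ List.replicate ((P.L - 1) / 2 + 1) (c.dir, true)))
          (List.replicate (P.L - 1 - (P.L - 1) / 2) (c.dir, true)))) := by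
    rw [replicate_split (P := P) c.dir, walk_append, holAt_append, hstep, holAt_cons]
    simp
  rw [loopHol_eq_openHol_mul]
  unfold openHol openWord
  simp only
  rw [walk_append, holAt_append, walk_append, holAt_append, hseg]
  simp only [mul_assoc]

/-- A holonomy along a walk avoiding every sheared bond is unchanged by the multi-shear `U ↦ U · (k ∘ qv⁻¹)` (plumbing). [folklore] -/
theorem holAt_mulRight_extend_of_forall_ne (U : GaugeField P j G) (k : ι → G) {γ : List (LStep P j)} (h : ∀ s ∈ γ, ∀ i, s.bond ≠ qv i) :
    holAt (fun b => U b * Function.extend qv k (fun _ => 1) b) γ = holAt U γ := by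
  refine holAt_congr fun s hs => ?_
  show U s.bond * Function.extend qv k (fun _ => 1) s.bond = U s.bond
  rw [Function.extend_apply' _ _ _ fun ⟨i, hi⟩ => h s hs i hi.symm, mul_one]

include hqv in
/-- The multi-shear fixes the coarse bond variable `U(c)` (the axis meets no off-axis crossing bond; standing range). [folklore] -/
theorem axialAvg_mulRight_extend (hj : j + 1 ≤ P.m + P.K) (hc : ∀ i, ¬ IsCentral c (rv i, 1, 1)) (U : GaugeField P j G) (k : ι → G) :
    axialAvg (fun b => U b * Function.extend qv k (fun _ => 1) b) c = axialAvg U c := by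
  rw [axialAvg_eq_holAt_walk, axialAvg_eq_holAt_walk]
  exact holAt_mulRight_extend_of_forall_ne qv U k fun s hs i' => ne_cross_of_mem_walk_axis c rv qv hqv hj (hc i') hs

include hqv h0 in
/-- **THE MULTI-SHEAR CHANGES THE LOOP OF INDEX `(r, 1, 1)` ONLY THROUGH ITS OWN CROSSING BOND**: right-multiplying each `U(qv i′)` (non-central, pairwise
distinct offsets) by its own `k i′` fixes the factors `X`, `Y` — no staircase bond, no other segment bond and no axis bond is a crossing bond — and sends
`U(qv i) ↦ U(qv i) · k i` (standing range). [cite: Balaban1987RG1, (0.4) p.253 (bookkeeping)] -/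
theorem loopHol_mulRight_extend (hj : j + 1 ≤ P.m + P.K) (hrv : Function.Injective rv) (hc : ∀ i, ¬ IsCentral c (rv i, 1, 1))
    (U : GaugeField P j G) (k : ι → G) (i : ι) :
    loopHol (fun b => U b * Function.extend qv k (fun _ => 1) b) c (rv i, 1, 1) =
      (holAt U (walk (emb c.src) (stairWord 1 (off (rv i)))) *
          holAt U (walk (walkEnd (emb c.src) (stairWord 1 (off (rv i)))) (List.replicate ((P.L - 1) / 2) (c.dir, true)))) *
        (U (qv i) * k i) *
        (holAt U (walk (walkEnd (emb c.src) (stairWord 1 (off (rv i)) ++ List.replicate ((P.L - 1) / 2 + 1) (c.dir, true)))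
              (List.replicate (P.L - 1 - (P.L - 1) / 2) (c.dir, true))) *
            holAt U (walk (walkEnd (walkEnd (emb c.src) (stairWord 1 (off (rv i)))) (List.replicate P.L (c.dir, true)))
              (wordRev (stairWord 1 (off (rv i))))) *
          (axialAvg U c)⁻¹) := by
  have hq' : Function.extend qv k (fun _ => 1) (qv i) = k i := (cross_injective c rv qv hqv hj hrv).extend_apply _ _ i
  rw [loopHol_eq_mul_apply_cross_mul c rv qv hqv _ i, hq',
    holAt_mulRight_extend_of_forall_ne qv U k fun s hs i' => ne_cross_of_mem_walk_stairWord c rv qv hqv (h0 i) 1 _ hs _,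
    holAt_mulRight_extend_of_forall_ne qv U k fun s hs i' => ne_cross_of_mem_walk_prefix c rv qv hqv h0 hj i hs i',
    holAt_mulRight_extend_of_forall_ne qv U k fun s hs i' => ne_cross_of_mem_walk_suffix c rv qv hqv h0 hj i hs i',
    holAt_mulRight_extend_of_forall_ne qv U k fun s hs i' => ne_cross_of_mem_walk_wordRev_stairWord c rv qv hqv (h0 i) 1 _ hs _,
    axialAvg_mulRight_extend c rv qv hqv hj hc]

end Shear

end Summit.QuantumFields.YangMills.BalabanUVNodes.N08HaarCompatibilityGuardCrossing

end
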